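import Summits.AtomisticToContinuum.BoseEinsteinCondensation.Theorems.BECBathMassLiouvilleFrozenBathNoBECLocal
import Summits.AtomisticToContinuum.BoseEinsteinCondensation.Theorems.BECBathMassLiouvilleFrozenBathNoBECBracketing
import Summits.AtomisticToContinuum.BoseEinsteinCondensation.Theorems.BECBathMassLiouvilleFrozenBathNoBECVoid
import Summits.AtomisticToContinuum.BoseEinsteinCondensation.Theorems.BECBathMassLiouvilleFrozenBathNoBECProbability
import HarnessLib

/-!
# Route BECBathMassLiouville — `FrozenBathNoBEC` (stmt-AtomisticToContinuum-13803), helper file 6: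
# the two exceptional sets have probability `≤ ε/2` each, and the void / occupation geometry

Specialisation of the volume estimates of helper file 5 to the sub-cell tilings used in the proof:

* the inner cubes `ℓq + R₀ + [0, ℓ-2R₀)³` of the sub-cells `ℓq + [0,ℓ)³` (a scatterer there has its
  range ball inside the sub-cell, `closedBall_subset_subCell_of_mem_inner`);
* `volume_manyEmpty_le`: `|{Y ∈ cell^M | εk³/4 ≤ #{q | inner cube q empty}}| ≤ (ε/2)|cell^M|` as
  soon as `(1 - (ℓ-2R₀)³/L³)^M ≤ ε²/8` (Markov);
* `volume_noVoid_le`: `|{Y ∈ cell^M | no sub-cell of side ℓ' is empty}| ≤ (ε/2)|cell^M|` as soon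
  as `2/ε ≤ (K-1)((K-1)/K)^M`, `K = k'³` (second moment);
* `iInf_quenched_le_of_emptyCell`: an empty sub-cell of side `ℓ' ≥ s + 2R₀` bounds the quenched
  ground-state energy by `s⁻² E₀(1,1)`.
-/

noncomputable section

namespace Summit.AtomisticToContinuum.BoseEinsteinCondensation.Theorems.FrozenBath

open MeasureTheory Metric Set Filter
open scoped ENNReal NNReal
open Literature.MathematicalPhysics.QuantumManyBody.BoseGas

variable {L : ℝ} {k : ℕ} {ℓ R₀ : ℝ}

/-! ## Inner cubes of the sub-cells -/

/-- Coordinates of the corner `ℓq + R₀` of the inner cube of sub-cell `q`. [folklore] -/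
theorem subOffset_add_apply (ℓ R₀ : ℝ) (q : SubIdx k) (i : Fin 3) :
    (subOffset ℓ q + (WithLp.toLp 2 fun _ : Fin 3 => R₀ : Space)) i = ℓ * ((q i : ℕ) : ℝ) + R₀ := by
  rw [PiLp.add_apply, subOffset_apply, PiLp.toLp_apply]

/-- Membership in the inner cube `ℓq + R₀ + [0, ℓ - 2R₀)³`, in coordinates. [folklore] -/
theorem mem_inner_iff {q : SubIdx k} {y : Space} :
    y ∈ cellShift (ℓ - 2 * R₀) (subOffset ℓ q + (WithLp.toLp 2 fun _ : Fin 3 => R₀ : Space)) ↔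
      ∀ i, ℓ * ((q i : ℕ) : ℝ) + R₀ ≤ y i ∧ y i < ℓ * ((q i : ℕ) : ℝ) + ℓ - R₀ := by
  rw [mem_cellShift]
  refine forall_congr' fun i => ?_
  rw [subOffset_add_apply]
  constructor <;> rintro ⟨h1, h2⟩ <;> constructor <;> linarith

/-- **A scatterer in the inner cube has its range ball inside the sub-cell.** [folklore] -/
theorem closedBall_subset_subCell_of_mem_inner {q : SubIdx k} {y : Space}
    (hy : y ∈ cellShift (ℓ - 2 * R₀) (subOffset ℓ q + (WithLp.toLp 2 fun _ : Fin 3 => R₀ : Space))) :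
    closedBall y R₀ ⊆ subCell ℓ q := by
  rw [mem_inner_iff] at hy
  refine closedBall_subset_cellShift fun i => ?_
  obtain ⟨h1, h2⟩ := hy i
  rw [subOffset_apply]
  constructor <;> linarith

/-- The inner cube lies in its sub-cell (`R₀ ≥ 0`). [folklore] -/
theorem inner_subset_subCell (hR₀ : 0 ≤ R₀) (q : SubIdx k) :
    cellShift (ℓ - 2 * R₀) (subOffset ℓ q + (WithLp.toLp 2 fun _ : Fin 3 => R₀ : Space)) ⊆
      subCell ℓ q := by
  intro y hy
  rw [mem_inner_iff] at hy
  rw [mem_subCell]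
  intro i
  obtain ⟨h1, h2⟩ := hy i
  constructor <;> linarith

/-- The inner cube lies in the big cell `[0,kℓ)³` (`R₀ ≥ 0`, `ℓ > 0`). [folklore] -/
theorem inner_subset_cell (hℓ : 0 < ℓ) (hR₀ : 0 ≤ R₀) (q : SubIdx k) :
    cellShift (ℓ - 2 * R₀) (subOffset ℓ q + (WithLp.toLp 2 fun _ : Fin 3 => R₀ : Space)) ⊆
      cell (k * ℓ) :=
  (inner_subset_subCell hR₀ q).trans (subCell_subset_cell hℓ q)

/-- `#(Fin 3 → Fin k) = k³`. [folklore] -/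
theorem card_subIdx (k : ℕ) : Fintype.card (SubIdx k) = k ^ 3 := by
  simp [SubIdx]

/-! ## Many empty inner cubes: probability `≤ ε/2` -/

/-- `(1 - c/L³)^M (L³)^M = (L³ - c)^M`. [folklore] -/
theorem one_sub_div_pow_mul {c : ℝ} (hL : 0 < L) (M : ℕ) :
    (1 - c / L ^ 3) ^ M * (L ^ 3) ^ M = (L ^ 3 - c) ^ M := by
  rw [← mul_pow]
  congr 1
  field_simp

/-- **Markov bound, specialised**: if `(1 - (ℓ-2R₀)³/L³)^M ≤ ε²/8` then the configurations with at
least `εk³/4` empty inner cubes have volume `≤ (ε/2) |cell^M|` (`L = kℓ`, `0 ≤ 2R₀ < ℓ`). [folklore] -/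
theorem volume_manyEmpty_le (hℓ : 0 < ℓ) (hk : 1 ≤ k) (hkℓ : (k : ℝ) * ℓ = L) (hR₀ : 0 ≤ R₀)
    (h2R : 2 * R₀ < ℓ) {ε : ℝ} (hε : 0 < ε) {M : ℕ}
    (hdev : (1 - (ℓ - 2 * R₀) ^ 3 / L ^ 3) ^ M ≤ ε ^ 2 / 8)
    [∀ Y : Config M, DecidablePred fun q : SubIdx k => ∀ j, Y j ∉
      cellShift (ℓ - 2 * R₀) (subOffset ℓ q + (WithLp.toLp 2 fun _ : Fin 3 => R₀ : Space))] :
    volume {Y : Config M | Y ∈ cellN M L ∧ ENNReal.ofReal (ε * (k : ℝ) ^ 3 / 4) ≤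
        ((Finset.univ.filter fun q : SubIdx k => ∀ j, Y j ∉
          cellShift (ℓ - 2 * R₀) (subOffset ℓ q + (WithLp.toLp 2 fun _ : Fin 3 => R₀ : Space))).card :
            ℝ≥0∞)} ≤
      ENNReal.ofReal (ε / 2) * volume (cellN M L) := by
  have hkpos : (0 : ℝ) < k := by exact_mod_cast hk
  have hL : 0 < L := by rw [← hkℓ]; exact mul_pos hkpos hℓ
  have hℓL : ℓ ≤ L := by
    rw [← hkℓ]
    have : (1 : ℝ) ≤ k := by exact_mod_cast hk
    nlinarith
  set S : SubIdx k → Set Space := fun q =>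
    cellShift (ℓ - 2 * R₀) (subOffset ℓ q + (WithLp.toLp 2 fun _ : Fin 3 => R₀ : Space)) with hS
  have hSm : ∀ q, MeasurableSet (S q) := fun q => measurableSet_cellShift _ _
  have hSsub : ∀ q, S q ⊆ cell L := fun q => by
    rw [← hkℓ]; exact inner_subset_cell hℓ hR₀ q
  have hσ : ∀ q, volume (S q) = ENNReal.ofReal (ℓ - 2 * R₀) ^ 3 := fun q => volume_cellShift _ _
  set t : ℝ≥0∞ := ENNReal.ofReal (ε * (k : ℝ) ^ 3 / 4) with ht
  have ht0 : t ≠ 0 := by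
    rw [ht, ne_eq, ENNReal.ofReal_eq_zero, not_le]; positivity
  have htt : t ≠ ⊤ := ENNReal.ofReal_ne_top
  have hE2 := mul_volume_count_le (L := L) (M := M) S hSm hSsub hσ t
  rw [card_subIdx] at hE2
  -- the right-hand side in real terms
  have hc0 : 0 ≤ (ℓ - 2 * R₀) ^ 3 := by
    have : 0 ≤ ℓ - 2 * R₀ := by linarith
    positivity
  have hcL : (ℓ - 2 * R₀) ^ 3 ≤ L ^ 3 := by
    have : ℓ - 2 * R₀ ≤ L := by linarith
    have h0 : 0 ≤ ℓ - 2 * R₀ := by linarith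
    exact pow_le_pow_left₀ h0 this 3
  have hrhs : ((k ^ 3 : ℕ) : ℝ≥0∞) * (ENNReal.ofReal L ^ 3 - ENNReal.ofReal (ℓ - 2 * R₀) ^ 3) ^ M =
      ENNReal.ofReal ((k : ℝ) ^ 3 * (L ^ 3 - (ℓ - 2 * R₀) ^ 3) ^ M) := by
    rw [← ENNReal.ofReal_pow hL.le, ← ENNReal.ofReal_pow (by linarith : 0 ≤ ℓ - 2 * R₀),
      ← ENNReal.ofReal_sub _ hc0, ← ENNReal.ofReal_pow (by linarith),
      ENNReal.ofReal_mul (by positivity)]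
    congr 1
    push_cast
    rw [ENNReal.ofReal_pow hkpos.le, ENNReal.ofReal_natCast]
  have hV : volume (cellN M L) = ENNReal.ofReal ((L ^ 3) ^ M) := by
    rw [volume_cellN, ← ENNReal.ofReal_pow hL.le, ← ENNReal.ofReal_pow (by positivity)]
  -- the real inequality
  have hreal : (k : ℝ) ^ 3 * (L ^ 3 - (ℓ - 2 * R₀) ^ 3) ^ M ≤
      ε * (k : ℝ) ^ 3 / 4 * (ε / 2 * (L ^ 3) ^ M) := by
    rw [← one_sub_div_pow_mul hL M]
    have h1 : (1 - (ℓ - 2 * R₀) ^ 3 / L ^ 3) ^ M * (L ^ 3) ^ M ≤ ε ^ 2 / 8 * (L ^ 3) ^ M :=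
      mul_le_mul_of_nonneg_right hdev (by positivity)
    calc (k : ℝ) ^ 3 * ((1 - (ℓ - 2 * R₀) ^ 3 / L ^ 3) ^ M * (L ^ 3) ^ M)
        ≤ (k : ℝ) ^ 3 * (ε ^ 2 / 8 * (L ^ 3) ^ M) := by gcongr
      _ = ε * (k : ℝ) ^ 3 / 4 * (ε / 2 * (L ^ 3) ^ M) := by ring
  have hfin : t * volume {Y : Config M | Y ∈ cellN M L ∧ t ≤
      ((Finset.univ.filter fun q : SubIdx k => ∀ j, Y j ∉ S q).card : ℝ≥0∞)} ≤
      t * (ENNReal.ofReal (ε / 2) * volume (cellN M L)) := by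
    refine hE2.trans ?_
    rw [hrhs, hV, ht, ← ENNReal.ofReal_mul (by positivity), ← ENNReal.ofReal_mul (by positivity)]
    exact ENNReal.ofReal_le_ofReal hreal
  exact (ENNReal.mul_le_mul_iff_right ht0 htt).1 hfin

/-! ## No empty big sub-cell: probability `≤ ε/2` -/

/-- **Second-moment bound, specialised**: for the tiling of `[0,L)³ = [0,k'ℓ')³` by the `K = k'³`
sub-cells of side `ℓ'`, if `2/ε ≤ (K-1)((K-1)/K)^M` then the configurations leaving no sub-cell
empty have volume `≤ (ε/2)|cell^M|`. [folklore] -/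
theorem volume_noVoid_le {k' : ℕ} {ℓ' : ℝ} (hℓ' : 0 < ℓ') (hk' : 1 ≤ k') (hkℓ' : (k' : ℝ) * ℓ' = L)
    {ε : ℝ} (hε : 0 < ε) {M : ℕ}
    (hdev : 2 / ε ≤ ((k' ^ 3 - 1 : ℕ) : ℝ) * ((((k' ^ 3 - 1 : ℕ) : ℝ)) / ((k' ^ 3 : ℕ) : ℝ)) ^ M) :
    volume {Y : Config M | Y ∈ cellN M L ∧ ∀ q : SubIdx k', ∃ j, Y j ∈ subCell ℓ' q} ≤
      ENNReal.ofReal (ε / 2) * volume (cellN M L) := by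
  have hkpos : (0 : ℝ) < k' := by exact_mod_cast hk'
  have hL : 0 < L := by rw [← hkℓ']; exact mul_pos hkpos hℓ'
  set K : ℕ := k' ^ 3 with hKdef
  have hKpos : (0 : ℝ) < K := by rw [hKdef]; positivity
  have hdisj : Pairwise (Function.onFun Disjoint (subCell (k := k') ℓ')) := by
    rw [← Set.pairwise_univ]
    exact pairwiseDisjoint_subCell hℓ' _
  have hcover : ⋃ q : SubIdx k', subCell ℓ' q = cell L := by
    rw [iUnion_subCell_eq_cell hℓ', hkℓ']
  have hE3 := volume_noVoid_mul_le (L := L) (M := M) (subCell (k := k') ℓ')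
    (fun q => measurableSet_subCell ℓ' q) hdisj hcover (fun q => volume_subCell ℓ' q)
    (ENNReal.pow_ne_top ENNReal.ofReal_ne_top)
  rw [card_subIdx, ← hKdef] at hE3
  set D := {Y : Config M | Y ∈ cellN M L ∧ ∀ q : SubIdx k', ∃ j, Y j ∈ subCell ℓ' q} with hD
  set V : ℝ≥0∞ := volume (cellN M L) with hVdef
  -- identify `(Kτ)^M` with `V`
  have hτ3 : ENNReal.ofReal ℓ' ^ 3 = ENNReal.ofReal (ℓ' ^ 3) := (ENNReal.ofReal_pow hℓ'.le 3).symm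
  have hL3 : L ^ 3 = (K : ℝ) * ℓ' ^ 3 := by
    rw [← hkℓ', hKdef]; push_cast; ring
  have hVeq : ((K : ℕ) : ℝ≥0∞) * ENNReal.ofReal ℓ' ^ 3 = ENNReal.ofReal L ^ 3 := by
    rw [hτ3, ← ENNReal.ofReal_natCast, ← ENNReal.ofReal_mul (by positivity), ← hL3,
      ENNReal.ofReal_pow hL.le]
  have hV : V = (ENNReal.ofReal L ^ 3) ^ M := by rw [hVdef, volume_cellN]
  rw [hVeq, ← hV] at hE3
  have hV0 : V ≠ 0 := by
    rw [hV]; exact pow_ne_zero _ (pow_ne_zero _ (by simpa using hL))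
  have hVt : V ≠ ⊤ := by
    rw [hV]; exact ENNReal.pow_ne_top (ENNReal.pow_ne_top ENNReal.ofReal_ne_top)
  -- `ofReal (2/ε) * V ≤ (K-1) ((K-1)τ)^M`
  have hG : ENNReal.ofReal (2 / ε) * V ≤
      ((K - 1 : ℕ) : ℝ≥0∞) * (((K - 1 : ℕ) : ℝ≥0∞) * ENNReal.ofReal ℓ' ^ 3) ^ M := by
    have hreal : 2 / ε * ((K : ℝ) * ℓ' ^ 3) ^ M ≤
        ((K - 1 : ℕ) : ℝ) * ((((K - 1 : ℕ) : ℝ)) * ℓ' ^ 3) ^ M := by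
      have hq : ((((K - 1 : ℕ) : ℝ)) * ℓ' ^ 3) ^ M =
          ((((K - 1 : ℕ) : ℝ)) / (K : ℝ)) ^ M * ((K : ℝ) * ℓ' ^ 3) ^ M := by
        rw [← mul_pow]
        congr 1
        field_simp
      rw [hq, ← mul_assoc]
      exact mul_le_mul_of_nonneg_right hdev (by positivity)
    have h1 : ENNReal.ofReal (2 / ε) * V = ENNReal.ofReal (2 / ε * ((K : ℝ) * ℓ' ^ 3) ^ M) := by
      rw [hV, ← ENNReal.ofReal_pow hL.le, hL3, ← ENNReal.ofReal_pow (by positivity),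
        ← ENNReal.ofReal_mul (by positivity)]
    have h2 : ((K - 1 : ℕ) : ℝ≥0∞) * (((K - 1 : ℕ) : ℝ≥0∞) * ENNReal.ofReal ℓ' ^ 3) ^ M =
        ENNReal.ofReal (((K - 1 : ℕ) : ℝ) * ((((K - 1 : ℕ) : ℝ)) * ℓ' ^ 3) ^ M) := by
      rw [hτ3, ← ENNReal.ofReal_natCast, ← ENNReal.ofReal_mul (by positivity),
        ← ENNReal.ofReal_pow (by positivity), ← ENNReal.ofReal_mul (by positivity)]
    rw [h1, h2]
    exact ENNReal.ofReal_le_ofReal hreal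
  -- conclude
  have hDV : volume D * (ENNReal.ofReal (2 / ε) * V) ≤ V * V := by
    calc volume D * (ENNReal.ofReal (2 / ε) * V)
        ≤ volume D * (((K - 1 : ℕ) : ℝ≥0∞) * (((K - 1 : ℕ) : ℝ≥0∞) * ENNReal.ofReal ℓ' ^ 3) ^ M) :=
          mul_le_mul_right hG _
      _ ≤ V ^ 2 := hE3
      _ = V * V := sq V
  have h3 : volume D * ENNReal.ofReal (2 / ε) ≤ V := by
    rw [← mul_assoc] at hDV
    exact (ENNReal.mul_le_mul_iff_left hV0 hVt).1 hDV
  have h2ε : ENNReal.ofReal (2 / ε) ≠ 0 := by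
    rw [ne_eq, ENNReal.ofReal_eq_zero, not_le]; positivity
  calc volume D ≤ V / ENNReal.ofReal (2 / ε) := by
        rw [ENNReal.le_div_iff_mul_le (Or.inl h2ε) (Or.inl ENNReal.ofReal_ne_top)]
        exact h3
    _ = ENNReal.ofReal (ε / 2) * V := by
        rw [div_eq_mul_inv, ← ENNReal.ofReal_inv_of_pos (by positivity), inv_div, mul_comm]

/-! ## An empty big sub-cell is a void -/

/-- **An empty sub-cell of side `ℓ' ≥ s + 2R₀` bounds the quenched ground-state energy by
`s⁻² E₀(1,1)`** (helper file 4 applied to the inner cube `ℓ'q + R₀ + (0, ℓ' - 2R₀)³`). [folklore] -/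
theorem iInf_quenched_le_of_emptyCell {v : ℝ → ℝ≥0∞} (hv0 : ∀ r, R₀ < r → v r = 0)
    (hR₀ : 0 ≤ R₀) {k' : ℕ} {ℓ' : ℝ} (hℓ' : 0 < ℓ') (hkℓ' : (k' : ℝ) * ℓ' = L) {s : ℝ} (hs : 0 < s)
    (hsℓ : s + 2 * R₀ ≤ ℓ') {M : ℕ} {Y : Config M} (hY : Y ∈ cellN M L) {q : SubIdx k'}
    (hq : ∀ j, Y j ∉ subCell ℓ' q) :
    (⨅ θ : PeriodicTrialState 1 L, ∫⁻ X in cellN 1 L, kineticDensity θ.ψ X +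
        (∑ j, periodizedPotential v L (X 0 - Y j)) * (‖θ.ψ X‖₊ : ℝ≥0∞) ^ 2) ≤
      ENNReal.ofReal (s ^ 2)⁻¹ * groundStateEnergy 0 1 1 := by
  have hk' : (1 : ℝ) ≤ k' := by
    have hqlt := (q 0).isLt
    have : 1 ≤ k' := Nat.one_le_of_lt hqlt
    exact_mod_cast this
  have hL : 0 < L := by rw [← hkℓ']; nlinarith
  set a : Space := subOffset ℓ' q + (WithLp.toLp 2 fun _ : Fin 3 => R₀ : Space) with hadef
  have ha_apply : ∀ i, a i = ℓ' * ((q i : ℕ) : ℝ) + R₀ := fun i => subOffset_add_apply ℓ' R₀ q i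
  have hs' : 0 < ℓ' - 2 * R₀ := by linarith
  have ha : ∀ i, 0 ≤ a i - R₀ := fun i => by
    rw [ha_apply]
    have : (0 : ℝ) ≤ (q i : ℕ) := Nat.cast_nonneg _
    nlinarith
  have hb : ∀ i, a i + (ℓ' - 2 * R₀) + R₀ ≤ L := fun i => by
    rw [ha_apply, ← hkℓ']
    have : ((q i : ℕ) : ℝ) + 1 ≤ k' := by exact_mod_cast (q i).isLt
    nlinarith
  have hempty : ∀ j, ¬ ∀ i, a i - R₀ < Y j i ∧ Y j i < a i + (ℓ' - 2 * R₀) + R₀ := by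
    intro j h
    refine hq j ?_
    rw [mem_subCell]
    intro i
    have hi := h i
    rw [ha_apply] at hi
    constructor <;> linarith [hi.1, hi.2]
  have hss' : ENNReal.ofReal ((ℓ' - 2 * R₀) ^ 2)⁻¹ ≤ ENNReal.ofReal (s ^ 2)⁻¹ := by
    refine ENNReal.ofReal_le_ofReal ?_
    rw [inv_le_inv₀ (by positivity) (by positivity)]
    exact pow_le_pow_left₀ hs.le (by linarith) 2
  calc _ ≤ ENNReal.ofReal ((ℓ' - 2 * R₀) ^ 2)⁻¹ * groundStateEnergy 0 1 1 :=
        iInf_quenched_le_of_void hv0 hR₀ hL (fun j => hY j) hs' ha hb hempty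
    _ ≤ ENNReal.ofReal (s ^ 2)⁻¹ * groundStateEnergy 0 1 1 := mul_le_mul_left hss' _

end Summit.AtomisticToContinuum.BoseEinsteinCondensation.Theorems.FrozenBath

end
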